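import Mathlib

/-!
# SoloBlind artefact 7 — lattice blindness of the zero-side Weil functional (Theorem D1)

Context (soloist `solo-RiemannHypothesis-blind`, claim C32, report `paper/window-height.md` §1).
For a test function `g` supported in a window and a point `z` of the critical strip written in the
rotated coordinate `w = γ - i(β - 1/2)`, put `H_g(z) = ∫ g(x) e^{izx} dx`.  The zero side of Weil's
explicit formula for `g ⋆ g̃` is the Hermitian form `Σ_ρ H_g(w_ρ) · conj (H_g (conj w_ρ))`; a zero OFF
the critical line by `δ` contributes (together with its mirror image) `2 · Re [H_g(u - iδ) · conj H_g(u + iδ)]`,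
a zero ON the line contributes `|H_g(u)|²`.

**Theorem D1 (blindness above the density threshold).**  Let `s > 0` and let `g ∈ L²(ℝ)` be supported
in an interval of length `2π/s` (e.g. the window `(-a, a]` with `s ≤ π/a`).  For the lattice configuration
`u_j = u₀ + j s` (`j ∈ ℤ`) moved off the line by an ARBITRARY amount `δ`,

  `Σ_j H_g(u_j - iδ) · conj (H_g(u_j + iδ)) = (2π/s) · ‖g‖₂²`,

independently of `δ` (and of `u₀`); in particular the zero-side functional of the totally off-line lattice
coincides with that of the on-line lattice (`δ = 0`).  Since the local spacing of the zeta zeros at height `T`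
is `2π / log (T/2π)`, the threshold `s = π/a` is the height `T = 2π e^{2a}`: an argument that uses only the
zero side of the explicit formula on the window `(-a, a)` cannot see the horizontal position of zeros above
height `≈ 2π e^{2a}`.  (The companion detection theorem D3 of the report shows that Weil positivity on the
window `(-a, a)` DOES control every zero below height `2π e^{2(a-ε)}`; only D1 is formalised here.)

Proof: with `G_± = e^{i u₀ x} e^{±δ x} g` one has `H_g(u_j ∓ iδ) = T · ĉ_{-j}(G_±)` (`T = 2π/s`, Fourier
coefficients on the circle `ℝ/Tℤ`), and the polarised Parseval identity on `L²(ℝ/Tℤ)` gives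
`Σ_j conj (ĉ_j(G_-)) ĉ_j(G_+) = T⁻¹ ∫ conj (G_-) G_+ = T⁻¹ ‖g‖₂²` — the weights `e^{±δx}` cancel.  No smoothness
of `g` is needed.  Mathlib only (`fourierBasis`, `HilbertBasis.hasSum_inner_mul_inner`).
-/

open MeasureTheory Complex Set AddCircle
open scoped Real ComplexConjugate InnerProductSpace

namespace Summit.RiemannHypothesis.RiemannHypothesis.Theorems

/-- Polarised Parseval identity for two `L²` functions on an interval `(c, c + T]`:
`Σ_i conj (ĉ_i f) · ĉ_i g = T⁻¹ ∫_c^{c+T} conj f · g` (unconditional convergence). -/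
theorem soloBlind_hasSum_conj_fourierCoeffOn_mul {c T : ℝ} (hT : 0 < T) {f g : ℝ → ℂ}
    (hf : MemLp f 2 (volume.restrict (Ioc c (c + T))))
    (hg : MemLp g 2 (volume.restrict (Ioc c (c + T)))) :
    HasSum (fun i : ℤ => conj (fourierCoeffOn (lt_add_of_pos_right c hT) f i) *
        fourierCoeffOn (lt_add_of_pos_right c hT) g i)
      (T⁻¹ • ∫ x in c..c + T, conj (f x) * g x) := by
  haveI : Fact (0 < T) := ⟨hT⟩
  have hF := hf.memLp_liftIoc.haarAddCircle
  have hG := hg.memLp_liftIoc.haarAddCircle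
  have key := (fourierBasis (T := T)).hasSum_inner_mul_inner hF.toLp hG.toLp
  have hcf : ∀ i : ℤ, fourierCoeff (hF.toLp : Lp ℂ 2 (haarAddCircle (T := T))) i =
      fourierCoeffOn (lt_add_of_pos_right c hT) f i := fun i => by
    rw [fourierCoeff_congr_ae hF.coeFn_toLp, fourierCoeff_liftIoc_eq]
  have hcg : ∀ i : ℤ, fourierCoeff (hG.toLp : Lp ℂ 2 (haarAddCircle (T := T))) i =
      fourierCoeffOn (lt_add_of_pos_right c hT) g i := fun i => by
    rw [fourierCoeff_congr_ae hG.coeFn_toLp, fourierCoeff_liftIoc_eq]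
  have hsummand : ∀ i : ℤ,
      ⟪hF.toLp, fourierBasis (T := T) i⟫_ℂ * ⟪fourierBasis (T := T) i, hG.toLp⟫_ℂ =
      conj (fourierCoeffOn (lt_add_of_pos_right c hT) f i) *
        fourierCoeffOn (lt_add_of_pos_right c hT) g i := fun i => by
    rw [← hcf, ← hcg, ← fourierBasis_repr, ← fourierBasis_repr, HilbertBasis.repr_apply_apply,
      HilbertBasis.repr_apply_apply, inner_conj_symm]
  have hval : ⟪hF.toLp, hG.toLp⟫_ℂ = T⁻¹ • ∫ x in c..c + T, conj (f x) * g x := by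
    rw [L2.inner_def]
    have hae : (fun t : AddCircle T =>
        ⟪(hF.toLp : AddCircle T → ℂ) t, (hG.toLp : AddCircle T → ℂ) t⟫_ℂ) =ᵐ[haarAddCircle]
        liftIoc T c (fun x => conj (f x) * g x) := by
      filter_upwards [hF.coeFn_toLp, hG.coeFn_toLp] with t h1 h2
      rw [h1, h2, RCLike.inner_apply']
      rfl
    rw [integral_congr_ae hae, AddCircle.integral_haarAddCircle,
      AddCircle.integral_liftIoc_eq_intervalIntegral]
  simpa only [hsummand, hval] using key

/-- If `g` vanishes off `(c, d]`, any function vanishing wherever `g` does integrates over `ℝ` as over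
`(c, d]`. -/
theorem soloBlind_integral_eq_intervalIntegral_of_support {E : Type*} [NormedAddCommGroup E]
    [NormedSpace ℝ E] {c d : ℝ} (hcd : c ≤ d) {g : ℝ → ℂ} {F : ℝ → E}
    (hsupp : Function.support g ⊆ Ioc c d) (hF : ∀ x, g x = 0 → F x = 0) :
    ∫ x, F x = ∫ x in c..d, F x := by
  rw [intervalIntegral.integral_of_le hcd, setIntegral_eq_integral_of_forall_compl_eq_zero]
  intro x hx
  apply hF
  by_contra h
  exact hx (hsupp h)

/-- Exponent bookkeeping: `e^{i (u - iδ) x} = e^{i j s x} · e^{i u₀ x} · e^{δ x}` for `u = u₀ + j s`,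
with `e^{i j s x}` written as the Fourier monomial of the circle of length `2π/s`. -/
theorem soloBlind_exp_split_minus (u₀ s δ x : ℝ) (j : ℤ) (hs : s ≠ 0) :
    cexp (I * (((u₀ + j * s : ℝ) : ℂ) - I * δ) * x) =
      cexp (2 * π * I * j * x / ((2 * π / s : ℝ) : ℂ)) *
        (cexp (((u₀ * x : ℝ) : ℂ) * I) * ((Real.exp (δ * x) : ℝ) : ℂ)) := by
  have hs' : (s : ℂ) ≠ 0 := by exact_mod_cast hs
  have hπ : (π : ℂ) ≠ 0 := by exact_mod_cast Real.pi_ne_zero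
  have h1 : 2 * π * I * j * x / ((2 * π / s : ℝ) : ℂ) = I * j * s * x := by
    push_cast
    field_simp
  rw [h1, Complex.ofReal_exp, ← Complex.exp_add, ← Complex.exp_add]
  congr 1
  push_cast
  have hI : I * I = -1 := Complex.I_mul_I
  linear_combination (-(δ : ℂ) * x) * hI

/-- Same with `+ iδ`: `e^{i (u + iδ) x} = e^{i j s x} · e^{i u₀ x} · e^{-δ x}`. -/
theorem soloBlind_exp_split_plus (u₀ s δ x : ℝ) (j : ℤ) (hs : s ≠ 0) :
    cexp (I * (((u₀ + j * s : ℝ) : ℂ) + I * δ) * x) =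
      cexp (2 * π * I * j * x / ((2 * π / s : ℝ) : ℂ)) *
        (cexp (((u₀ * x : ℝ) : ℂ) * I) * ((Real.exp (-δ * x) : ℝ) : ℂ)) := by
  have hs' : (s : ℂ) ≠ 0 := by exact_mod_cast hs
  have hπ : (π : ℂ) ≠ 0 := by exact_mod_cast Real.pi_ne_zero
  have h1 : 2 * π * I * j * x / ((2 * π / s : ℝ) : ℂ) = I * j * s * x := by
    push_cast
    field_simp
  rw [h1, Complex.ofReal_exp, ← Complex.exp_add, ← Complex.exp_add]
  congr 1
  push_cast
  have hI : I * I = -1 := Complex.I_mul_I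
  linear_combination ((δ : ℂ) * x) * hI

/-- A Fourier monomial integrated against `G` over one period is `T` times a Fourier coefficient. -/
theorem soloBlind_intervalIntegral_fourier_mul {c T : ℝ} (hT : 0 < T) (G : ℝ → ℂ) (j : ℤ) :
    ∫ x in c..c + T, cexp (2 * π * I * j * x / (T : ℂ)) * G x =
      (T : ℂ) * fourierCoeffOn (lt_add_of_pos_right c hT) G (-j) := by
  rw [fourierCoeffOn_eq_integral, Complex.real_smul]
  simp only [fourier_coe_apply, smul_eq_mul, neg_neg, add_sub_cancel_left]
  rw [← mul_assoc]
  have : (T : ℂ) * ((1 / T : ℝ) : ℂ) = 1 := by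
    have hT' : (T : ℂ) ≠ 0 := by exact_mod_cast hT.ne'
    push_cast
    field_simp
  rw [this, one_mul]

/-- **Theorem D1 (lattice blindness), interval form.**  For `g ∈ L²(ℝ)` supported in `(c, c + 2π/s]` and the
lattice `u_j = u₀ + j s` pushed off the line by `δ`:  `Σ_j H_g(u_j - iδ) · conj H_g(u_j + iδ) = (2π/s) ‖g‖₂²`,
with `H_g(z) = ∫ g(x) e^{izx} dx`.  The right-hand side does not depend on `δ`. -/
theorem soloBlind_lattice_blindness (c s u₀ δ : ℝ) (hs : 0 < s) {g : ℝ → ℂ}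
    (hg : MemLp g 2 volume) (hsupp : Function.support g ⊆ Ioc c (c + 2 * π / s)) :
    HasSum (fun j : ℤ =>
        (∫ x : ℝ, g x * cexp (I * (((u₀ + j * s : ℝ) : ℂ) - I * δ) * x)) *
        conj (∫ x : ℝ, g x * cexp (I * (((u₀ + j * s : ℝ) : ℂ) + I * δ) * x)))
      ((((2 * π / s) * ∫ x : ℝ, ‖g x‖ ^ 2 : ℝ)) : ℂ) := by
  set T : ℝ := 2 * π / s with hTdef
  have hT : 0 < T := by rw [hTdef]; positivity
  have hcT : c ≤ c + T := by linarith
  -- the two weighted copies of `g`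
  set Gp : ℝ → ℂ := fun x => cexp (((u₀ * x : ℝ) : ℂ) * I) * ((Real.exp (δ * x) : ℝ) : ℂ) * g x
    with hGp_def
  set Gm : ℝ → ℂ := fun x => cexp (((u₀ * x : ℝ) : ℂ) * I) * ((Real.exp (-δ * x) : ℝ) : ℂ) * g x
    with hGm_def
  -- pointwise bounds `‖G_± x‖ ≤ C ‖g x‖`
  have hxbound : ∀ x, g x ≠ 0 → |x| ≤ |c| + |c + T| := by
    intro x hx
    have hxI : x ∈ Ioc c (c + T) := hsupp hx
    rw [abs_le]
    constructor
    · linarith [hxI.1, neg_abs_le c, abs_nonneg (c + T)]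
    · linarith [hxI.2, le_abs_self (c + T), abs_nonneg c]
  have hwbound : ∀ (ε x : ℝ), |ε| ≤ |δ| → g x ≠ 0 →
      ‖cexp (((u₀ * x : ℝ) : ℂ) * I) * ((Real.exp (ε * x) : ℝ) : ℂ)‖ ≤
        Real.exp (|δ| * (|c| + |c + T|)) := by
    intro ε x hε hx
    rw [norm_mul, Complex.norm_exp_ofReal_mul_I, one_mul, Complex.norm_real, Real.norm_eq_abs,
      abs_of_pos (Real.exp_pos _), Real.exp_le_exp]
    calc ε * x ≤ |ε * x| := le_abs_self _
      _ = |ε| * |x| := abs_mul ε x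
      _ ≤ |δ| * (|c| + |c + T|) := by
          apply mul_le_mul hε (hxbound x hx) (abs_nonneg _) (abs_nonneg _)
  have hGbound : ∀ (ε : ℝ), |ε| ≤ |δ| → ∀ x,
      ‖cexp (((u₀ * x : ℝ) : ℂ) * I) * ((Real.exp (ε * x) : ℝ) : ℂ) * g x‖ ≤
        Real.exp (|δ| * (|c| + |c + T|)) * ‖g x‖ := by
    intro ε hε x
    by_cases hx : g x = 0
    · simp [hx]
    · rw [norm_mul]
      exact mul_le_mul_of_nonneg_right (hwbound ε x hε hx) (norm_nonneg _)
  have hmeas : ∀ ε : ℝ, AEStronglyMeasurable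
      (fun x => cexp (((u₀ * x : ℝ) : ℂ) * I) * ((Real.exp (ε * x) : ℝ) : ℂ) * g x)
      (volume.restrict (Ioc c (c + T))) := by
    intro ε
    have hc : Continuous fun x : ℝ => cexp (((u₀ * x : ℝ) : ℂ) * I) * ((Real.exp (ε * x) : ℝ) : ℂ) := by
      fun_prop
    exact hc.aestronglyMeasurable.mul hg.aestronglyMeasurable.restrict
  have hGp : MemLp Gp 2 (volume.restrict (Ioc c (c + T))) :=
    (hg.restrict (Ioc c (c + T))).of_le_mul (c := Real.exp (|δ| * (|c| + |c + T|))) (hmeas δ)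
      (Filter.Eventually.of_forall (hGbound δ le_rfl))
  have hGm : MemLp Gm 2 (volume.restrict (Ioc c (c + T))) :=
    (hg.restrict (Ioc c (c + T))).of_le_mul (c := Real.exp (|δ| * (|c| + |c + T|))) (hmeas (-δ))
      (Filter.Eventually.of_forall (hGbound (-δ) (by rw [abs_neg])))
  -- the two integrals as Fourier coefficients of `G_±` on the circle of length `T`
  have hA : ∀ j : ℤ, (∫ x : ℝ, g x * cexp (I * (((u₀ + j * s : ℝ) : ℂ) - I * δ) * x)) =
      (T : ℂ) * fourierCoeffOn (lt_add_of_pos_right c hT) Gp (-j) := by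
    intro j
    have hfun : (fun x : ℝ => g x * cexp (I * (((u₀ + j * s : ℝ) : ℂ) - I * δ) * x)) =
        fun x : ℝ => cexp (2 * π * I * j * (x : ℂ) / (T : ℂ)) * Gp x := by
      funext x
      rw [soloBlind_exp_split_minus u₀ s δ x j hs.ne', ← hTdef, hGp_def]
      ring
    rw [hfun, soloBlind_integral_eq_intervalIntegral_of_support hcT hsupp
        (F := fun x : ℝ => cexp (2 * π * I * j * (x : ℂ) / (T : ℂ)) * Gp x)
        (fun x hx => by simp [hGp_def, hx]),
      soloBlind_intervalIntegral_fourier_mul hT Gp j]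
  have hB : ∀ j : ℤ, (∫ x : ℝ, g x * cexp (I * (((u₀ + j * s : ℝ) : ℂ) + I * δ) * x)) =
      (T : ℂ) * fourierCoeffOn (lt_add_of_pos_right c hT) Gm (-j) := by
    intro j
    have hfun : (fun x : ℝ => g x * cexp (I * (((u₀ + j * s : ℝ) : ℂ) + I * δ) * x)) =
        fun x : ℝ => cexp (2 * π * I * j * (x : ℂ) / (T : ℂ)) * Gm x := by
      funext x
      rw [soloBlind_exp_split_plus u₀ s δ x j hs.ne', ← hTdef, hGm_def]
      ring
    rw [hfun, soloBlind_integral_eq_intervalIntegral_of_support hcT hsupp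
        (F := fun x : ℝ => cexp (2 * π * I * j * (x : ℂ) / (T : ℂ)) * Gm x)
        (fun x hx => by simp [hGm_def, hx]),
      soloBlind_intervalIntegral_fourier_mul hT Gm j]
  -- polarised Parseval for `(G_-, G_+)`, re-indexed by `j ↦ -j`, scaled by `T²`
  have key := soloBlind_hasSum_conj_fourierCoeffOn_mul hT hGm hGp
  have key2 : HasSum (fun j : ℤ => conj (fourierCoeffOn (lt_add_of_pos_right c hT) Gm (-j)) *
      fourierCoeffOn (lt_add_of_pos_right c hT) Gp (-j))
      (T⁻¹ • ∫ x in c..c + T, conj (Gm x) * Gp x) :=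
    (Equiv.neg ℤ).hasSum_iff.mpr key
  have key3 := key2.mul_left ((T : ℂ) ^ 2)
  -- the value: the weights cancel pointwise
  have hpt : ∀ x, conj (Gm x) * Gp x = ((‖g x‖ ^ 2 : ℝ) : ℂ) := by
    intro x
    have h1 : conj (cexp (((u₀ * x : ℝ) : ℂ) * I)) * cexp (((u₀ * x : ℝ) : ℂ) * I) = 1 := by
      rw [Complex.conj_mul', Complex.norm_exp_ofReal_mul_I]; simp
    have h2 : ((Real.exp (-δ * x) : ℝ) : ℂ) * ((Real.exp (δ * x) : ℝ) : ℂ) = 1 := by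
      rw [← Complex.ofReal_mul, ← Real.exp_add]; simp
    have h3 : conj (g x) * g x = ((‖g x‖ ^ 2 : ℝ) : ℂ) := by
      rw [Complex.conj_mul']; push_cast; ring
    simp only [hGm_def, hGp_def, map_mul, Complex.conj_ofReal]
    calc conj (cexp (((u₀ * x : ℝ) : ℂ) * I)) * ((Real.exp (-δ * x) : ℝ) : ℂ) * conj (g x) *
          (cexp (((u₀ * x : ℝ) : ℂ) * I) * ((Real.exp (δ * x) : ℝ) : ℂ) * g x)
        = (conj (cexp (((u₀ * x : ℝ) : ℂ) * I)) * cexp (((u₀ * x : ℝ) : ℂ) * I)) *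
          (((Real.exp (-δ * x) : ℝ) : ℂ) * ((Real.exp (δ * x) : ℝ) : ℂ)) * (conj (g x) * g x) := by
          ring
      _ = ((‖g x‖ ^ 2 : ℝ) : ℂ) := by rw [h1, h2, h3]; ring
  have hval : (T⁻¹ • ∫ x in c..c + T, conj (Gm x) * Gp x) =
      ((T⁻¹ * ∫ x : ℝ, ‖g x‖ ^ 2 : ℝ) : ℂ) := by
    rw [Complex.real_smul]
    simp_rw [hpt]
    rw [intervalIntegral.integral_ofReal,
      ← soloBlind_integral_eq_intervalIntegral_of_support hcT hsupp (F := fun x => ‖g x‖ ^ 2)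
        (fun x hx => by simp [hx])]
    push_cast
    ring
  have hT' : (T : ℂ) ≠ 0 := by exact_mod_cast hT.ne'
  have hfun_eq : (fun j : ℤ =>
        (∫ x : ℝ, g x * cexp (I * (((u₀ + j * s : ℝ) : ℂ) - I * δ) * x)) *
        conj (∫ x : ℝ, g x * cexp (I * (((u₀ + j * s : ℝ) : ℂ) + I * δ) * x))) =
      fun j : ℤ => (T : ℂ) ^ 2 * (conj (fourierCoeffOn (lt_add_of_pos_right c hT) Gm (-j)) *
        fourierCoeffOn (lt_add_of_pos_right c hT) Gp (-j)) := by
    funext j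
    rw [hA j, hB j]
    simp only [map_mul, Complex.conj_ofReal]
    ring
  have hval_eq : (((T * ∫ x : ℝ, ‖g x‖ ^ 2 : ℝ)) : ℂ) =
      (T : ℂ) ^ 2 * (T⁻¹ • ∫ x in c..c + T, conj (Gm x) * Gp x) := by
    rw [hval]
    push_cast
    field_simp
  rw [hfun_eq, hval_eq]
  exact key3

/-- **Theorem D1, window form (the statement of the report): the off-line lattice is invisible.**
Let `0 < s ≤ π/a` and let `g ∈ L²` be supported in the window `(-a, a]`.  For the configuration
`u_j ∓ iδ`, `u_j = u₀ + j s`, the zero-side functional `Σ_j 2 Re [H_g(u_j - iδ) conj H_g(u_j + iδ)]`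
equals `(4π/s) ‖g‖₂²` WHATEVER `δ` is — the same value as for the on-line lattice (`δ = 0`). -/
theorem soloBlind_lattice_blindness_window (a s u₀ δ : ℝ) (ha : 0 < a) (hs : 0 < s)
    (hsa : s ≤ π / a) {g : ℝ → ℂ} (hg : MemLp g 2 volume)
    (hsupp : Function.support g ⊆ Ioc (-a) a) :
    HasSum (fun j : ℤ => 2 *
        ((∫ x : ℝ, g x * cexp (I * (((u₀ + j * s : ℝ) : ℂ) - I * δ) * x)) *
         conj (∫ x : ℝ, g x * cexp (I * (((u₀ + j * s : ℝ) : ℂ) + I * δ) * x))).re)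
      ((4 * π / s) * ∫ x : ℝ, ‖g x‖ ^ 2) := by
  have hsub : Ioc (-a) a ⊆ Ioc (-a) (-a + 2 * π / s) := by
    apply Ioc_subset_Ioc le_rfl
    have h1 : s * a ≤ π := by rwa [le_div_iff₀ ha] at hsa
    have h2 : 2 * a ≤ 2 * π / s := by
      rw [le_div_iff₀ hs]
      linarith
    linarith
  have h := soloBlind_lattice_blindness (-a) s u₀ δ hs hg (hsupp.trans hsub)
  have h2 := (h.mapL Complex.reCLM).mul_left (2 : ℝ)
  simp only [Complex.reCLM_apply, Complex.ofReal_re] at h2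
  have hv : (4 * π / s) * ∫ x : ℝ, ‖g x‖ ^ 2 = 2 * ((2 * π / s) * ∫ x : ℝ, ‖g x‖ ^ 2) := by ring
  rw [hv]
  exact h2

/-- **Blindness as an identity of functionals**: for `g ∈ L²` supported in an interval of length `2π/s`,
the lattice functional with offset `δ` equals the lattice functional with offset `0`. -/
theorem soloBlind_lattice_offline_eq_online (c s u₀ δ : ℝ) (hs : 0 < s) {g : ℝ → ℂ}
    (hg : MemLp g 2 volume) (hsupp : Function.support g ⊆ Ioc c (c + 2 * π / s)) :
    (∑' j : ℤ, (∫ x : ℝ, g x * cexp (I * (((u₀ + j * s : ℝ) : ℂ) - I * δ) * x)) *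
        conj (∫ x : ℝ, g x * cexp (I * (((u₀ + j * s : ℝ) : ℂ) + I * δ) * x))) =
    ∑' j : ℤ, (∫ x : ℝ, g x * cexp (I * (((u₀ + j * s : ℝ) : ℂ) - I * (0 : ℝ)) * x)) *
        conj (∫ x : ℝ, g x * cexp (I * (((u₀ + j * s : ℝ) : ℂ) + I * (0 : ℝ)) * x)) := by
  rw [(soloBlind_lattice_blindness c s u₀ δ hs hg hsupp).tsum_eq,
    (soloBlind_lattice_blindness c s u₀ 0 hs hg hsupp).tsum_eq]

end Summit.RiemannHypothesis.RiemannHypothesis.Theorems
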